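/-
Copyright: cell pub-balaban-gaps (YM BLITZ Y1, track G1), seat g1-p2 GEN 8 (unit `pub-balaban-gaps-g1-p2`).  Row (D4) NODE O,
JUNCTION J-3 (multi-level) — PRINT'S (3.37) LITERALLY: the bond field is `U = e^{X}` (`X = iηA′`, fundamental representation on `ℂ^N`)
with the windows ON `X` — `Σ_c|X_μ(y)_{ac}| ≤ a₀L^{−lev y}` («|A′| < α₁(L^jη)^{−1}» times `η`), `Σ_c|(X_μ(x) − X_μ(x − e_μ))_{ac}| ≤ a₁L^{−2lev x}`
(«|∇A′| < α₁(L^jη)^{−2}» times `η²`) — and the conclusion is Cor. 3.5 for the GREEN FUNCTION of the covariant multi-level operator of `U`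
on [4]'s nested family: a block walk expansion, unconditionally (84), with the bond-field windows DERIVED from those on `X` by 61a's
exponential algebra (`α₀ = a₀e^{a₀}`, `α₁ = a₁e^{La₀}`).  HONEST FRAMING: `X` is a hypothesis SHAPE (the small field in Bałaban's gauge is
NOT produced from the class (3.35)–(3.36): D-O2-3a); holomorphy of `u ↦ e^{±X(u)}` is taken as data (as in 74); the flat operator is the
lineage's scalar model ⊗ 1; (D4) NOT discharged (instance 0∕1); NOT BetaPertH, NOT continuum, NOT Clay.
-/
import Summits.QuantumFields.BalabanUV.Gaps.D4WalkBlockCovariantGreenMultiLevel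

/-!
# `Gaps.D4WalkBlockCovariantExpFieldMultiLevel` — Cor. 3.5 for the Green function of the covariant multi-level operator of
# `U = e^{X}` with print's (3.37) windows on `X`, on [4]'s nested family (cell pub-balaban-gaps, seat g1-p2 gen 8)

HONEST DEPENDENCY (cell pub-balaban, verbatim): continuum YM on T⁴ ⇐ BetaPertH ∧ nine spine estimates (0/9 proved);
BetaPertH ⇐ (D1) ∧ (D4) ∧ CAP+tail.

* §1 `expWindow_bond` (`Σ|(e^{±X} − 1)| ≤ (a₀e^{a₀})L^{−lev}` from `Σ|X| ≤ a₀L^{−lev}`, `L^{−lev} ≤ 1`), **`expWindow_deriv`**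
  (`Σ|(e^{X(x)} − e^{X(x−e_μ)})| ≤ (a₁e^{La₀})L^{−2lev x}` — both exponents bounded by `La₀L^{−lev x}` since neighbours' levels differ by ≤ 1);
* §2 **`blockWalkExpansion_covariantGreenExp_multiLevelTorus`** — 84's theorem for `U = e^{X}`, `U⁻¹ = e^{−X}`, with the (3.37) windows
  on `X`: the Green function `(Δ_W(e^X) + L^{2k}·covAvgOp(e^X, Γ))⁻¹` is a block walk expansion with Cor. 3.5's letters; margin with
  `α₀ = a₀e^{a₀}`, `α₁ = a₁e^{La₀}`; constants uniform in `k`, the torus, `{Ω_j}`, `N`, `Γ`.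
WHAT IT IS NOT.  (3.35)–(3.36) ⟹ (3.37) (the gauge); the adjoint representation; (D4) instance 0∕1; words of row (D4) UNCHANGED.

References: T. Bałaban, Comm. Math. Phys. **99** (1985) 389–434 [B9], (3.37) p. 396, (3.50) p. 400, (3.62)–(3.64) p. 402, (3.78) p. 406,
Cor. 3.5 p. 407; Comm. Math. Phys. **96** (1984) [4], (2.13)–(2.14) p. 225.
-/

noncomputable section

namespace Summit.QuantumFields.BalabanUV.Gaps.D4WalkBlockCovariantExpFieldMultiLevel

open Metric NormedSpace
open scoped Matrix
open Literature.MathematicalPhysics.QuantumFieldTheory.Balaban1983to89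
open Literature.MathematicalPhysics.QuantumFieldTheory.Balaban1983to89.B4Reflection242 (boxDom blk)
open Literature.MathematicalPhysics.QuantumFieldTheory.Balaban1983to89.B9SectDWalk (DomBy)
open Literature.MathematicalPhysics.QuantumFieldTheory.Balaban1983to89.B9Thm34Ext (toB6)
open Literature.MathematicalPhysics.QuantumFieldTheory.Balaban1983to89.B9Thm37GlueTorus (torusGeom tdist1)
open Literature.MathematicalPhysics.QuantumFieldTheory.Balaban1983to89.TreeLengthTorus (TPt)
open Literature.MathematicalPhysics.QuantumFieldTheory.Balaban1983to89.B5TorusCover (UT)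
open Literature.MathematicalPhysics.QuantumFieldTheory.Balaban1983to89.B11SectG (RowSum)
open Literature.MathematicalPhysics.QuantumFieldTheory.Balaban1983to89.B6MultiLevelBoxOperator (N0)
open Literature.MathematicalPhysics.QuantumFieldTheory.Balaban1983to89.B6MultiLevelTorusOperator (TDomains gmlT tshift unitVec)
open Literature.MathematicalPhysics.QuantumFieldTheory.Balaban1983to89.B6Ineq243TwoLevelBox (aNext)
open Summit.QuantumFields.BalabanUV.Gaps.D4WalkBlock (blockNorm BlockWalkExpansion)
open Summit.QuantumFields.BalabanUV.Gaps.D4WalkBlockMultiLevelGeometry (cubeML)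
open Summit.QuantumFields.BalabanUV.Gaps.D4WalkBlockTransportAlgebra (rowSumNorm)
open Summit.QuantumFields.BalabanUV.Gaps.D4WalkBlockExpWindow (rowSumNorm_neg rowSumNorm_exp_sub_one_le rowSumNorm_exp_sub_exp_le
  exp_sub_one_le_eps)
open Summit.QuantumFields.BalabanUV.Gaps.D4WalkBlockShiftStep (covLap)
open Summit.QuantumFields.BalabanUV.Gaps.D4WalkBlockShiftWeighted (covDopW covBW covAlphaW)
open Summit.QuantumFields.BalabanUV.Gaps.D4WalkBlockWeightedLettersMultiLevel (levW)
open Summit.QuantumFields.BalabanUV.Gaps.D4WalkBlockCovariantAveragingMultiLevel (covAvgOp)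
open Summit.QuantumFields.BalabanUV.Gaps.D4WalkBlockCovariantContourMultiLevel (contourT contourTi)
open Summit.QuantumFields.BalabanUV.Gaps.D4WalkBlockCovariantBondFieldMultiLevel (inv_pow_lev_tshift_symm_le)
open Summit.QuantumFields.BalabanUV.Gaps.D4WalkBlockCovariantGreenMultiLevel (blockWalkExpansion_covariantGreen_multiLevelTorus)

variable {d : ℕ}

/-! ## §1. The bond-field windows from the windows on `X` -/

section Windows

variable {ℓ Mh k R : ℕ} {P : Fin (d + 1) → ℕ} {D : TDomains d ℓ Mh k P R} {N : ℕ}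
variable {E : Type*} [NormedAddCommGroup E] [NormedSpace ℂ E]
variable {X : Fin (d + 1) → E → ↥(boxDom (N0 ℓ Mh k P)) → Matrix (Fin N) (Fin N) ℂ} {a₀ a₁ Rb : ℝ}

omit [NormedSpace ℂ E] in
/-- `L^{−lev y} ≤ 1`. -/
theorem inv_pow_lev_le_one (y : ↥(boxDom (N0 ℓ Mh k P))) : ((((ℓ : ℝ) + 1) ^ D.lev y.1))⁻¹ ≤ 1 := by
  have hL1 : (1 : ℝ) ≤ (ℓ : ℝ) + 1 := by linarith [(Nat.cast_nonneg ℓ : (0 : ℝ) ≤ ℓ)]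
  exact inv_le_one_of_one_le₀ (one_le_pow₀ hL1)

omit [NormedSpace ℂ E] in
/-- **BOND WINDOW OF `e^{±X} − 1`**: `Σ_c|X_{ac}| ≤ a₀L^{−lev y}` ⟹ `Σ_c|(e^{±X} − 1)_{ac}| ≤ (a₀e^{a₀})·L^{−lev y}`.
[cite: Balaban1985BackgroundPropagators, (3.37) p.396] -/
theorem expWindow_bond (ha₀ : 0 ≤ a₀)
    (hX0 : ∀ ν, ∀ u ∈ ball (0 : E) Rb, ∀ y a', rowSumNorm (X ν u y) a' ≤ a₀ * ((((ℓ : ℝ) + 1) ^ D.lev y.1))⁻¹) :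
    (∀ ν, ∀ u ∈ ball (0 : E) Rb, ∀ y a', ∑ b, ‖(exp (X ν u y) - 1) a' b‖ ≤ (a₀ * Real.exp a₀) * ((((ℓ : ℝ) + 1) ^ D.lev y.1))⁻¹) ∧
    (∀ ν, ∀ u ∈ ball (0 : E) Rb, ∀ y a', ∑ b, ‖(exp (-X ν u y) - 1) a' b‖ ≤ (a₀ * Real.exp a₀) * ((((ℓ : ℝ) + 1) ^ D.lev y.1))⁻¹) := by
  have key : ∀ (y : ↥(boxDom (N0 ℓ Mh k P))) (Y : Matrix (Fin N) (Fin N) ℂ),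
      (∀ a', rowSumNorm Y a' ≤ a₀ * ((((ℓ : ℝ) + 1) ^ D.lev y.1))⁻¹) →
        ∀ a', rowSumNorm (exp Y - 1) a' ≤ (a₀ * Real.exp a₀) * ((((ℓ : ℝ) + 1) ^ D.lev y.1))⁻¹ := by
    intro y Y hY a'
    have ht0 : 0 ≤ ((((ℓ : ℝ) + 1) ^ D.lev y.1))⁻¹ := by positivity
    have ht1 := inv_pow_lev_le_one (D := D) y
    have hs : 0 ≤ ((((ℓ : ℝ) + 1) ^ D.lev y.1))⁻¹ * a₀ := by positivity
    have h1 := rowSumNorm_exp_sub_one_le Y hs (fun b => by rw [mul_comm]; exact hY b) a'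
    have h2 := exp_sub_one_le_eps ht0 ht1 ha₀
    calc _ ≤ _ := h1
      _ ≤ _ := h2
      _ = _ := by ring
  refine ⟨fun ν u hu y a' => key y _ (hX0 ν u hu y) a', fun ν u hu y a' => key y _ (fun b => ?_) a'⟩
  rw [rowSumNorm_neg]; exact hX0 ν u hu y b

omit [NormedSpace ℂ E] in
/-- **DERIVATIVE WINDOW OF `e^{X}`**: `Σ|X(x)| ≤ a₀L^{−lev x}`, `Σ|X(x − e_μ)| ≤ a₀L^{−lev(x−e_μ)} ≤ La₀L^{−lev x}`,
`Σ|X(x) − X(x − e_μ)| ≤ a₁L^{−2lev x}` ⟹ `Σ|(e^{X(x)} − e^{X(x−e_μ)})| ≤ (a₁e^{La₀})·L^{−2lev x}`.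
[cite: Balaban1985BackgroundPropagators, (3.37) p.396; Balaban1984PropagatorsII, (2.2) p.224] -/
theorem expWindow_deriv (hR : 1 ≤ R) (hMh : 1 ≤ Mh) (hP : ∀ i, 1 ≤ P i) (ha₀ : 0 ≤ a₀) (ha₁ : 0 ≤ a₁)
    (hX0 : ∀ ν, ∀ u ∈ ball (0 : E) Rb, ∀ y a', rowSumNorm (X ν u y) a' ≤ a₀ * ((((ℓ : ℝ) + 1) ^ D.lev y.1))⁻¹)
    (hX1 : ∀ ν, ∀ u ∈ ball (0 : E) Rb, ∀ x a', rowSumNorm (X ν u x - X ν u ((tshift (N0 ℓ Mh k P) (unitVec ν)).symm x)) a' ≤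
      a₁ * ((((ℓ : ℝ) + 1) ^ D.lev x.1))⁻¹ ^ 2) :
    ∀ ν, ∀ u ∈ ball (0 : E) Rb, ∀ x a',
      ∑ b, ‖(exp (X ν u x) - exp (X ν u ((tshift (N0 ℓ Mh k P) (unitVec ν)).symm x))) a' b‖ ≤
        (a₁ * Real.exp (((ℓ : ℝ) + 1) * a₀)) * ((((ℓ : ℝ) + 1) ^ D.lev x.1))⁻¹ ^ 2 := by
  intro ν u hu x a'
  have hL0 : (0 : ℝ) < (ℓ : ℝ) + 1 := by positivity
  have hL1 : (1 : ℝ) ≤ (ℓ : ℝ) + 1 := by linarith [(Nat.cast_nonneg ℓ : (0 : ℝ) ≤ ℓ)]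
  set t : ℝ := ((((ℓ : ℝ) + 1) ^ D.lev x.1))⁻¹ with ht
  have ht0 : 0 ≤ t := by positivity
  have ht1 : t ≤ 1 := inv_pow_lev_le_one (D := D) x
  have hs : 0 ≤ ((ℓ : ℝ) + 1) * a₀ * t := by positivity
  have hXs : ∀ b, rowSumNorm (X ν u x) b ≤ ((ℓ : ℝ) + 1) * a₀ * t := fun b =>
    (hX0 ν u hu x b).trans (by rw [mul_assoc]; exact le_mul_of_one_le_left (by positivity) hL1)
  have hYs : ∀ b, rowSumNorm (X ν u ((tshift (N0 ℓ Mh k P) (unitVec ν)).symm x)) b ≤ ((ℓ : ℝ) + 1) * a₀ * t := fun b =>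
    (hX0 ν u hu _ b).trans (le_of_le_of_eq (mul_le_mul_of_nonneg_left (inv_pow_lev_tshift_symm_le (D := D) hR hMh hP ν x) ha₀)
      (by rw [ht]; ring))
  have h := rowSumNorm_exp_sub_exp_le _ _ hs (by positivity : 0 ≤ a₁ * t ^ 2) hXs hYs (hX1 ν u hu x) a'
  calc _ ≤ a₁ * t ^ 2 * Real.exp (((ℓ : ℝ) + 1) * a₀ * t) := h
    _ ≤ a₁ * t ^ 2 * Real.exp (((ℓ : ℝ) + 1) * a₀) := by
        refine mul_le_mul_of_nonneg_left (Real.exp_le_exp.2 ?_) (by positivity)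
        exact mul_le_of_le_one_right (by positivity) ht1
    _ = _ := by ring

end Windows

/-! ## §2. Cor. 3.5 for the Green function of the covariant operator of `e^{X}` -/

section Green

variable {dd N' : ℕ} {E : Type*} [NormedAddCommGroup E] [NormedSpace ℂ E]

/-- **[B9] COR. 3.5 FOR THE GREEN FUNCTION OF THE COVARIANT MULTI-LEVEL OPERATOR OF `U = e^{X}` WITH PRINT'S (3.37) WINDOWS ON `X`,
ON THE GENUINE NESTED FAMILY.**  84's theorem with `U = e^{X}`, `U⁻¹ = e^{−X}` (`e^{X}e^{−X} = 1`), the bond-field windows derived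
from `Σ|X| ≤ a₀L^{−lev}`, `Σ|X(x) − X(x − e_μ)| ≤ a₁L^{−2lev x}` (§1): margin with `α₀ = a₀e^{a₀}`, `α₁ = a₁e^{La₀}`.
[cite: Balaban1985BackgroundPropagators, Cor. 3.5 p.407, (3.37) p.396, (3.62)–(3.64) p.402, (3.78) p.406; Balaban1984PropagatorsII, (2.13)–(2.14) p.225; Balaban1988RG2Cluster, (1.11) p.5] -/
theorem blockWalkExpansion_covariantGreenExp_multiLevelTorus (d ℓ : ℕ) (hℓ : 1 ≤ ℓ) (aminus aplus a2minus a2plus : ℝ)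
    (ha : 0 < aminus) (ha2 : 0 < a2minus) :
    ∃ δ₁ C M₀ : ℝ, ∃ N₀ : ℕ, 0 < δ₁ ∧ 0 < C ∧ 0 < M₀ ∧ 0 < N₀ ∧
      ∀ (k Mh R : ℕ), 3 ≤ Mh → M₀ ≤ ((ℓ : ℝ) + 1) * Mh → 2 * (ℓ + 1) ≤ R → N₀ + 1 ≤ R * ((ℓ + 1) * Mh) →
      ∀ (P : Fin (d + 1) → ℕ) (hP : ∀ μ, 1 ≤ P μ) (hP4 : ∀ μ, 4 ≤ P μ) (D : TDomains d ℓ Mh k P R) (a c : ℕ → ℝ),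
        (∀ i, 1 ≤ i → aminus ≤ a i ∧ a i ≤ aplus) → (∀ i, 1 ≤ i → a2minus ≤ c i ∧ c i ≤ a2plus) →
        (∀ i, 1 ≤ i → a (i + 1) = aNext ℓ (a i) (c i)) →
      ∀ (Kc : Fin (d + 1) → ℕ) [∀ i, NeZero (Kc i)], (∀ i, N0 ℓ Mh k P i = (ℓ + 1) ^ k * Kc i) →
      ∀ (N : ℕ) (c₀ : B13.Consts) (Xs : Finset (UT Kc)) (Rb : ℝ)
        (X : Fin (d + 1) → E → ↥(boxDom (N0 ℓ Mh k P)) → Matrix (Fin N) (Fin N) ℂ)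
        (Γ : ↥(boxDom (N0 ℓ Mh k P)) → List (↥(boxDom (N0 ℓ Mh k P)) × Fin (d + 1))) (a₀ a₁ ε μ cμ : ℝ),
      (∀ ν y a' b, DifferentiableOn ℂ (fun u => exp (X ν u y) a' b) (ball (0 : E) Rb)) →
      (∀ ν y a' b, DifferentiableOn ℂ (fun u => exp (-X ν u y) a' b) (ball (0 : E) Rb)) →
      0 ≤ a₀ → 0 ≤ a₁ →
      (∀ ν, ∀ u ∈ ball (0 : E) Rb, ∀ y a', rowSumNorm (X ν u y) a' ≤ a₀ * ((((ℓ : ℝ) + 1) ^ D.lev y.1))⁻¹) →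
      (∀ ν, ∀ u ∈ ball (0 : E) Rb, ∀ x a', rowSumNorm (X ν u x - X ν u ((tshift (N0 ℓ Mh k P) (unitVec ν)).symm x)) a' ≤
        a₁ * ((((ℓ : ℝ) + 1) ^ D.lev x.1))⁻¹ ^ 2) →
      (∀ x, (Γ x).length ≤ (d + 1) * (ℓ + 1) ^ D.lev x.1) →
      (∀ x, ∀ b ∈ Γ x, blk ((ℓ + 1) ^ D.lev x.1) b.1.1 = blk ((ℓ + 1) ^ D.lev x.1) x.1) →
      0 ≤ μ → 2 * μ ≤ ε → 2 * μ ≤ δ₁ - ε - μ → 0 ≤ cμ →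
      RowSum (toB6 (torusGeom Kc 0 0 0) 0 True) μ cμ →
      cμ * (cμ * 1 * (1 * ((0 + ∑ j : Unit ⊕ (Fin (d + 1) ⊕ Fin (d + 1)),
        covAlphaW (((ℓ : ℝ) + 1) * (a₀ * Real.exp a₀)) (((d : ℝ) + 1) * (a₁ * Real.exp (((ℓ : ℝ) + 1) * a₀) +
          (((ℓ : ℝ) + 1) * (a₀ * Real.exp a₀)) ^ 2) + aplus * (Real.exp (2 * ((d : ℝ) + 1) * (a₀ * Real.exp a₀)) - 1)) j * covBW δ₁ ((ℓ : ℝ) + 1) j) * C)) * cμ) * cμ < 1 →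
      ∃ (W : Type) (T : W → (TPt dd N' → ℂ) → E → Matrix (↥(boxDom (N0 ℓ Mh k P)) × Fin N) (↥(boxDom (N0 ℓ Mh k P)) × Fin N) ℂ)
        (SX' : Set W) (A' : W → ℝ) (D' : W → UT Kc → UT Kc → ℝ),
        BlockWalkExpansion c₀ (fun q : ↥(boxDom (N0 ℓ Mh k P)) × Fin N => cubeML ℓ k Kc q.1.1)
          (fun q : ↥(boxDom (N0 ℓ Mh k P)) × Fin N => cubeML ℓ k Kc q.1.1)
          (fun (_ : TPt dd N' → ℂ) u =>
            (covLap ↥(boxDom (N0 ℓ Mh k P)) (Fin N) (fun ν => tshift (N0 ℓ Mh k P) (unitVec ν)) ((((ℓ : ℝ) + 1) ^ k)⁻¹)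
                (fun ν u x => exp (X ν u x) - 1) (fun ν u x => exp (-X ν u ((tshift (N0 ℓ Mh k P) (unitVec ν)).symm x)) - 1) u +
              (((ℓ : ℂ) + 1) ^ (2 * k) : ℂ) • covAvgOp D a (contourT Γ fun u b => exp (X b.2 u b.1)) (contourTi Γ fun u b => exp (-X b.2 u b.1)) u)⁻¹)
          Xs Rb (ε - 2 * μ) (δ₁ - ε - μ - 2 * μ)
          (cμ * C * (1 * (1 - cμ * (cμ * 1 * (1 * ((0 + ∑ j : Unit ⊕ (Fin (d + 1) ⊕ Fin (d + 1)),
            covAlphaW (((ℓ : ℝ) + 1) * (a₀ * Real.exp a₀)) (((d : ℝ) + 1) * (a₁ * Real.exp (((ℓ : ℝ) + 1) * a₀) +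
              (((ℓ : ℝ) + 1) * (a₀ * Real.exp a₀)) ^ 2) + aplus * (Real.exp (2 * ((d : ℝ) + 1) * (a₀ * Real.exp a₀)) - 1)) j * covBW δ₁ ((ℓ : ℝ) + 1) j) * C)) * cμ) * cμ)⁻¹) * cμ)
          T SX' A' D' (δ₁ - 2 * μ) ∧
        (∀ (j : Unit ⊕ (Fin (d + 1) ⊕ Fin (d + 1))) ω (σ : TPt dd N' → ℂ), (∀ i, ‖σ i‖ ≤ Real.exp c₀.κ₁) →
          ∀ u ∈ ball (0 : E) Rb, ∀ Y Y',
          blockNorm (fun q : ↥(boxDom (N0 ℓ Mh k P)) × Fin N => cubeML ℓ k Kc q.1.1)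
              (fun q : ↥(boxDom (N0 ℓ Mh k P)) × Fin N => cubeML ℓ k Kc q.1.1)
              (covDopW ↥(boxDom (N0 ℓ Mh k P)) (Fin N) (fun ν => tshift (N0 ℓ Mh k P) (unitVec ν)) ((((ℓ : ℝ) + 1) ^ k)⁻¹) (levW D) j *
                T ω σ u) Y Y' ≤
            covBW (ι := Fin (d + 1)) δ₁ ((ℓ : ℝ) + 1) j * (A' ω * Real.exp (-((δ₁ - 2 * μ) * D' ω Y Y')))) ∧
        ∀ ω, DomBy (toB6 (torusGeom Kc 0 0 0) 0 True) (D' ω) := by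
  obtain ⟨δ₁, C, M₀, N₀, hδ₁, hC, hM₀, hN₀, hmain⟩ :=
    blockWalkExpansion_covariantGreen_multiLevelTorus (dd := dd) (N' := N') (E := E) d ℓ hℓ aminus aplus a2minus a2plus ha ha2
  refine ⟨δ₁, C, M₀, N₀, hδ₁, hC, hM₀, hN₀, ?_⟩
  intro k Mh R hMh hM hR hRM P hP hP4 D a c haw hcw hac Kc _ hKc N c₀ Xs Rb X Γ a₀ a₁ ε μ cμ hUh hUih ha₀ ha₁ hX0 hX1 hlen hblkΓ hμ
    hμε hμκ hcμ hrow hq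
  have hMh1 : 1 ≤ Mh := le_trans (by norm_num) hMh
  have hR1 : 1 ≤ R := le_trans (by omega) hR
  obtain ⟨hU0, hUi0⟩ := expWindow_bond (D := D) (X := X) ha₀ hX0
  have hU1 := expWindow_deriv (D := D) (X := X) hR1 hMh1 hP ha₀ ha₁ hX0 hX1
  have hinv : ∀ ν u y, exp (X ν u y) * exp (-X ν u y) = 1 := fun ν u y => by
    rw [Matrix.exp_neg]; exact Matrix.mul_nonsing_inv _ ((Matrix.isUnit_iff_isUnit_det _).1 (Matrix.isUnit_exp _))
  exact hmain k Mh R hMh hM hR hRM P hP hP4 D a c haw hcw hac Kc hKc (Fin N) c₀ Xs Rb (fun ν u y => exp (X ν u y))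
    (fun ν u y => exp (-X ν u y)) Γ (a₀ * Real.exp a₀) (a₁ * Real.exp (((ℓ : ℝ) + 1) * a₀)) ε μ cμ hUh hUih hinv (by positivity)
    (by positivity) hU0 hUi0 hU1 hlen hblkΓ hμ hμε hμκ hcμ hrow hq

end Green

end Summit.QuantumFields.BalabanUV.Gaps.D4WalkBlockCovariantExpFieldMultiLevel

end
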